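import Literature.AlgebraicGeometry.Resolution.RidgeRepresentable
import Mathlib.Algebra.Polynomial.Laurent
import Mathlib.RingTheory.MvPolynomial.Tower
import HarnessLib

/-!
# The ridge is a cone: `𝔾_m`-stability of `F` and homogeneity of its ideal `𝔉`

Topic: `Literature/AlgebraicGeometry/Resolution`. Sequel of `Ridge.lean` / `RidgeRepresentable.lean`.

> **Giraud 1975, §1.5.** "Ce foncteur est représentable par un sous-schéma en groupes fermé de
> `V`, **qui est aussi un cône**, autrement dit, `F` admet pour équations des polynômes additifs
> homogènes."

For a HOMOGENEOUS ideal `I ⊆ S = K[X_1, …, X_n]` (closed under homogeneous components, i.e.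
`Literature.RingTheory.HilbertSamuel.IsHomogeneousIdeal I`) we prove the cone property of
Giraud's ridge functor `F` (`ridge`) and of its ideal `𝔉 = ridgeIdeal I`:

* `aeval_smul_of_isHomogeneous` (`g(c · w) = c^d g(w)` for a form of degree `d`), the scalings
  `scaleX c : X ↦ cX` of `k'[X]`, `scaleX_mem_coneIdeal` (the cone `C ×_K k'` is `𝔾_m`-stable —
  indeed stable under every scalar), `scaleX_shift_scaleX` (`σ_a ∘ L_v ∘ σ_b = L_{bv}` for
  `ab = 1`);
* **`smul_mem_ridge`** — `F(k')` is stable under the units of `k'`: `u • v ∈ F(k')` for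
  `v ∈ F(k')`, `u ∈ (k')ˣ`;
* **`homogeneousComponent_mem_ridgeIdeal`** — **`𝔉` is a homogeneous ideal** (test `g ∈ 𝔉` at
  the point `T · v ∈ F(k'[T, T⁻¹])` and read off the coefficients of the Laurent polynomial
  `g(Tv) = Σ_d g_d(v) T^d`), whence `smul_mem_ridge'`: `F(k')` is stable under ALL scalars of `k'`
  (`𝔾_a`-cone), by representability (`mem_ridge_iff_forall_ridgeIdeal`, `k'` in the universe of `K`).

## References

* J. Giraud, *Contact maximal en caractéristique positive*, Ann. Sci. ÉNS 8 (1975), §1.5. [Giraud1975]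
* J. Berthomieu, P. Hivert, H. Mourtada, *Computing Hironaka's invariants: ridge and directrix*,
  Contemp. Math. 521 (2010), Prop.–Def. 2.1. [BerthomieuHivertMourtada2010]
-/

noncomputable section

open MvPolynomial Module
open Literature.RingTheory.MvPolynomial

namespace Literature.AlgebraicGeometry.Resolution

universe u v

variable {K : Type u} [Field K] {n : ℕ}

/-! ## Scalings -/

section Scale

/-- **Forms scale**: `g(c · w) = c^d · g(w)` for `g` homogeneous of degree `d`, `c ∈ A`, `w ∈ Aⁿ`,
`A` any commutative algebra. [folklore] -/
theorem aeval_smul_of_isHomogeneous {R : Type*} [CommRing R] {A : Type*} [CommRing A] [Algebra R A]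
    {g : MvPolynomial (Fin n) R} {d : ℕ} (hg : g.IsHomogeneous d) (c : A) (w : Fin n → A) :
    aeval (c • w) g = c ^ d * aeval w g := by
  classical
  conv_lhs => rw [g.as_sum, map_sum]
  conv_rhs => rw [g.as_sum, map_sum, Finset.mul_sum]
  refine Finset.sum_congr rfl fun m hm => ?_
  have hdeg : d = ∑ i ∈ m.support, m i := hg.degree_eq_sum_deg_support hm
  rw [aeval_monomial, aeval_monomial]
  simp only [Finsupp.prod, Pi.smul_apply, smul_eq_mul, mul_pow]
  rw [Finset.prod_mul_distrib, Finset.prod_pow_eq_pow_sum, ← hdeg]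
  ring

variable {k' : Type v} [CommRing k'] [Algebra K k']

variable (k') in
/-- The scaling `σ_c : X_j ↦ c X_j` of `k'[X]` (the action of `c ∈ 𝔸¹ ⊇ 𝔾_m` on the vector group).
[folklore] -/
def scaleX (c : k') : MvPolynomial (Fin n) k' →ₐ[k'] MvPolynomial (Fin n) k' :=
  aeval fun j => C c * X j

/-- `σ_c(X_j) = c X_j`. [folklore] -/
@[simp] theorem scaleX_X (c : k') (j : Fin n) : scaleX k' c (X j : MvPolynomial (Fin n) k') = C c * X j :=
  aeval_X _ j

/-- **`σ_c(p) = c^d p` for a form `p` of degree `d`.** [folklore] -/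
theorem scaleX_eq_of_isHomogeneous {p : MvPolynomial (Fin n) k'} {d : ℕ} (hp : p.IsHomogeneous d) (c : k') :
    scaleX k' c p = C c ^ d * p := by
  have hfun : (fun j => C c * X j : Fin n → MvPolynomial (Fin n) k') =
      (C c : MvPolynomial (Fin n) k') • (X : Fin n → MvPolynomial (Fin n) k') := by
    funext j
    rfl
  rw [scaleX, hfun, aeval_smul_of_isHomogeneous hp, aeval_X_left_apply]

variable {I : Ideal (MvPolynomial (Fin n) K)}

/-- **The cone `C ×_K k'` is stable under every scaling** (`I` homogeneous). [folklore] -/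
theorem scaleX_mem_coneIdeal (hI : ∀ f ∈ I, ∀ d : ℕ, homogeneousComponent d f ∈ I) (c : k')
    {g : MvPolynomial (Fin n) k'} (hg : g ∈ coneIdeal k' I) : scaleX k' c g ∈ coneIdeal k' I := by
  have hle : coneIdeal k' I ≤ Ideal.comap (scaleX k' c) (coneIdeal k' I) := by
    rw [coneIdeal, Ideal.map_le_iff_le_comap]
    intro f hf
    rw [Ideal.mem_comap, Ideal.mem_comap, ← sum_homogeneousComponent f, map_sum, map_sum]
    refine Ideal.sum_mem _ fun d _ => ?_
    rw [scaleX_eq_of_isHomogeneous ((homogeneousComponent_isHomogeneous d f).map _)]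
    exact Ideal.mul_mem_left _ _ (Ideal.mem_map_of_mem _ (hI f hf d))
  exact hle hg

/-- **`σ_a ∘ L_v ∘ σ_b = L_{b v}` when `ab = 1`.** [folklore] -/
theorem scaleX_shift_scaleX {a b : k'} (hab : a * b = 1) (v : Fin n → k') (p : MvPolynomial (Fin n) k') :
    scaleX k' a (shift v (scaleX k' b p)) = shift (b • v) p := by
  have h : ((scaleX k' a).comp (shift v)).comp (scaleX k' b) = shift (b • v) :=
    MvPolynomial.algHom_ext fun j => by
      simp only [AlgHom.comp_apply, scaleX_X, map_mul, shift_X, map_add, algHom_C,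
        MvPolynomial.algebraMap_eq, Pi.smul_apply, smul_eq_mul]
      rw [mul_add, ← mul_assoc, ← C_mul, mul_comm b a, hab, C_1, one_mul]
  exact AlgHom.congr_fun h p

/-- **`F(k')` is stable under the units of `k'`**: `u • v ∈ F(k')` for `v ∈ F(k')` and `u` a unit
(`L_{uv} = σ_{u⁻¹}⁻¹ ∘ L_v ∘ σ_{u⁻¹}`… precisely `σ_a ∘ L_v ∘ σ_u` with `au = 1`, and the cone is
`σ`-stable), for homogeneous `I`. [cite: Giraud1975, §1.5] -/
theorem smul_mem_ridge (hI : ∀ f ∈ I, ∀ d : ℕ, homogeneousComponent d f ∈ I) {u : k'} (hu : IsUnit u)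
    {v : Fin n → k'} (hv : v ∈ ridge k' I) : u • v ∈ ridge k' I := by
  obtain ⟨a, ha⟩ := hu.exists_left_inv
  intro g hg
  rw [← scaleX_shift_scaleX ha]
  exact scaleX_mem_coneIdeal hI a (hv _ (scaleX_mem_coneIdeal hI u hg))

end Scale

/-! ## `𝔉` is homogeneous -/

section Cone

variable {I : Ideal (MvPolynomial (Fin n) K)}

/-- The inclusion of constants `k' → k'[T, T⁻¹]` as a `K`-algebra map. [folklore] -/
def laurentC (k' : Type v) [CommRing k'] [Algebra K k'] : k' →ₐ[K] LaurentPolynomial k' :=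
  { LaurentPolynomial.C with commutes' := fun _ => rfl }

/-- `laurentC` is `LaurentPolynomial.C`. [folklore] -/
@[simp] theorem laurentC_apply {k' : Type v} [CommRing k'] [Algebra K k'] (a : k') :
    laurentC (K := K) k' a = LaurentPolynomial.C a :=
  rfl

/-- The coefficient of `T^d` in `Σ_e C(a_e) T^e`. [folklore] -/
theorem coeff_sum_C_mul_T {k' : Type v} [CommRing k'] (s : Finset ℕ) (a : ℕ → k') (d : ℕ) :
    (∑ e ∈ s, LaurentPolynomial.C (a e) * LaurentPolynomial.T (e : ℤ)).coeff (d : ℤ) =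
      if d ∈ s then a d else 0 := by
  classical
  rw [AddMonoidAlgebra.coeff_sum, Finset.sum_apply']
  have h : ∀ e ∈ s, ((LaurentPolynomial.C (a e) * LaurentPolynomial.T (e : ℤ)).coeff) (d : ℤ) =
      if d = e then a e else 0 := by
    intro e _
    rw [← LaurentPolynomial.single_eq_C_mul_T, AddMonoidAlgebra.coeff_single, Finsupp.single_apply]
    simp only [Nat.cast_inj, eq_comm]
  rw [Finset.sum_congr rfl h, Finset.sum_ite_eq]

/-- **The ideal of the ridge is homogeneous** (`F` "est aussi un cône"): every homogeneous component
of an element of `𝔉` lies in `𝔉`, for homogeneous `I`. Proof: for `v ∈ F(k')`, the point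
`T · v` lies in `F(k'[T, T⁻¹])` (`smul_mem_ridge`, `T` a unit), so `0 = g(Tv) = Σ_d g_d(v) T^d`
and each `g_d(v) = 0`. [cite: Giraud1975, §1.5] -/
theorem homogeneousComponent_mem_ridgeIdeal (hI : ∀ f ∈ I, ∀ d : ℕ, homogeneousComponent d f ∈ I)
    {g : MvPolynomial (Fin n) K} (hg : g ∈ ridgeIdeal I) (d : ℕ) :
    homogeneousComponent d g ∈ ridgeIdeal I := by
  classical
  intro k' _ _ v hv
  -- the point `T • v` of the ridge over the Laurent polynomials
  have hv' : (fun j => laurentC (K := K) k' (v j)) ∈ ridge (LaurentPolynomial k') I :=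
    map_mem_ridge (laurentC k') hv
  have hTv : (LaurentPolynomial.T 1 : LaurentPolynomial k') • (fun j => laurentC (K := K) k' (v j)) ∈
      ridge (LaurentPolynomial k') I :=
    smul_mem_ridge hI (LaurentPolynomial.isUnit_T 1) hv'
  have h0 := hg (LaurentPolynomial k') _ hTv
  -- `g(Tv) = Σ_e g_e(v) T^e`
  have hexp : aeval ((LaurentPolynomial.T 1 : LaurentPolynomial k') • fun j => laurentC (K := K) k' (v j)) g =
      ∑ e ∈ Finset.range (g.totalDegree + 1),
        LaurentPolynomial.C (aeval v (homogeneousComponent e g)) * LaurentPolynomial.T (e : ℤ) := by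
    conv_lhs => rw [← sum_homogeneousComponent g, map_sum]
    refine Finset.sum_congr rfl fun e _ => ?_
    rw [aeval_smul_of_isHomogeneous (homogeneousComponent_isHomogeneous e g), LaurentPolynomial.T_pow,
      mul_one, mul_comm]
    congr 1
    have hcomp : (fun j => laurentC (K := K) k' (v j)) = algebraMap k' (LaurentPolynomial k') ∘ v := by
      funext j
      rfl
    rw [hcomp, aeval_algebraMap_apply]
    rfl
  rw [hexp] at h0
  -- read off the coefficient of `T^d`
  have hcoeff := congrArg (fun p : LaurentPolynomial k' => p.coeff (d : ℤ)) h0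
  simp only [coeff_sum_C_mul_T, AddMonoidAlgebra.coeff_zero, Finsupp.coe_zero, Pi.zero_apply] at hcoeff
  by_cases hd : d ∈ Finset.range (g.totalDegree + 1)
  · rwa [if_pos hd] at hcoeff
  · rw [Finset.mem_range, not_lt, Nat.succ_le_iff] at hd
    rw [homogeneousComponent_eq_zero _ _ hd, map_zero]

/-- **`F(k')` is stable under ALL scalars of `k'`** (the ridge is a cone for the `𝔸¹`-action, not
only `𝔾_m`): by representability `F(k') = V(𝔉)(k')` with `𝔉` homogeneous, and `g_d(cv) = c^d g_d(v)`.
Here `k'` is in the universe of `K`. [cite: Giraud1975, §1.5] -/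
theorem smul_mem_ridge' (hI : ∀ f ∈ I, ∀ d : ℕ, homogeneousComponent d f ∈ I)
    {k' : Type u} [CommRing k'] [Algebra K k'] (c : k') {v : Fin n → k'} (hv : v ∈ ridge k' I) :
    c • v ∈ ridge k' I := by
  classical
  rw [mem_ridge_iff_forall_ridgeIdeal] at hv ⊢
  intro g hg
  rw [← sum_homogeneousComponent g, map_sum]
  refine Finset.sum_eq_zero fun d _ => ?_
  rw [aeval_smul_of_isHomogeneous (homogeneousComponent_isHomogeneous d g),
    hv _ (homogeneousComponent_mem_ridgeIdeal hI hg d), mul_zero]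

end Cone

end Literature.AlgebraicGeometry.Resolution

end
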